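/-
Copyright: harness21 operator infrastructure (2026). Not a cell file; not a gate target (HarnessLib/ is outside the
proposal layout and is maintained by direct operator commits).
-/
import Lean.LibrarySuggestions.Basic

/-!
# Build-lane export guard for the `Frobenioids` files (Literature/AlgebraicGeometry/Frobenioids/**)

Companion of `HarnessLib.LibrarySuggestionsDenyList` (the `HodgeCM` entry) and
`HarnessLib.Audit.LibrarySuggestionsDenyListCorCM`; see those files for the mechanism. Lean 4.32 runs the
library-suggestion indexers (`Lean.LibrarySuggestions.SymbolFrequency`, `SineQuaNon`, via their `exportEntriesFnEx`)
over every local theorem constant whenever an `.olean` is written; on the large dependent binder telescopes of the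
`Frobenioids` files that fold ran past the build lane's clock (incident G11b-3, 2026-08-21…28), which the ops-buildfix
seats worked around with a per-file `set_option allowUnsafeReducibility true in attribute [implicit_reducible] …`
footer. That option is banned (census 2026-08-29); this module is the sanctioned replacement (21-frontier ruling
2026-08-29T22:59:59Z): the files import it and drop the footer.

`Lean/LibrarySuggestions/Basic.lean` (§ `DenyList`) documents the switch:

> A premise whose name has one of the following components is not retrieved.
> Use `run_cmd modifyEnv fun env => nameDenyListExt.addEntry env name` to add a name to the deny list.

The single entry below adds the name component `Frobenioids` (the declarations of those files are named
`Literature.AlgebraicGeometry.Frobenioids.…`). It is a persistent environment-extension entry inherited by every module that imports this one,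
directly or transitively; `isDeniedPremise` tests it before any fold, so the export skips those constants. Nothing
else changes — no statement, proof, attribute, reducibility setting or option is touched; only effect: constants with
a `Frobenioids` name component are not offered by `+suggestions` premise selectors in importing modules.

Why this file lives under `HarnessLib/Audit/`: the gate regenerates the `HarnessLib.lean` root aggregator from every
module under `lean/HarnessLib/**` except the `HarnessLib.Audit.*` subtree (`regen_root_imports`), and `import HarnessLib`
has ~587 000 transitive importers; a module under `Audit/` stays out of the aggregator, so importing this file from the
`Frobenioids` files rebuilds exactly those files' downstream and nothing else.
-/

run_cmd Lean.modifyEnv (Lean.LibrarySuggestions.nameDenyListExt.addEntry · "Frobenioids")
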